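import Mathlib
import HarnessLib
import Literature.MathematicalPhysics.QuantumLattice.FermionRelabelling
import Summits.HubbardSuperconductivity.HubbardSuperconductivity.Theorems.ThermalWedgeTwSeededEnsembleEquivalenceRBondSums
import Summits.HubbardSuperconductivity.HubbardSuperconductivity.Theorems.WeakCouplingBCSWcbcsBcsConstructionBoxTilingRectangles

/-!
# Route `ThermalWedge`, crux `TwSeededEnsembleEquivalenceR` (stmt-HubbardSuperconductivity-15581):
# free energies of pair-sourced Hubbard rectangles — relabelling, boundary counts, row and column cuts

Support file (`--supports stmt-HubbardSuperconductivity-15581`; no definition; the route file is NOT imported).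
Fourth layer of the infrastructure for the registered stub `stub_sourcedPressureLimit`. The `m × n` rectangle is
the vertex type `Lex (Fin m × Fin n)` with the nearest-neighbour graph pulled back from `ℤ²` (as in
`WeakCouplingBCSWcbcsBcsConstructionBoxTilingRectangles.lean`, whose adjacency bookkeeping is reused); the pair
weights are `w(p, q) = ω(q - p)` for an arbitrary translation-invariant NEAREST-NEIGHBOUR kernel
`ω : (Fin 2 → ℤ) → ℂ` (`‖ω‖ ≤ 1`, `ω(b - a) ≠ 0 → a ∼ b`); the route's d-wave source is `ω = ĝ_d/√2`.

* `twR_partitionFn_sourced_relabel` — covariance of `Z_β(H(G,w))` under graph isomorphisms (tree `relabel`;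
  the ground-energy analogue is `dlsb_groundEnergy_sourced_eq_of_iso` of route `DeformationLadder`);
* `twR_boundary_sum_le` — the boundary sums of `twR_sourcedCutEstimate` are `≤ (2|t| + 4|h|) ·` (number of ordered
  adjacent pairs across the cut);
* rectangles: the volume bound `|log Z(m,n) - mn log z₀| ≤ 4βmn(2|t|+4|h|)`, transposition
  `Z_{n×m}(ω ∘ swap) = Z_{m×n}(ω)`, the **row cut** `|log Z(m₁+m₂,n) - log Z(m₁,n) - log Z(m₂,n)| ≤ 2βn(2|t|+4|h|)`
  and the **column cut** (by transposition).

Ruelle, *Statistical Mechanics: Rigorous Results* (1969) §2.2. Everything is [folklore].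
-/

set_option linter.dupNamespace false

noncomputable section

namespace Summit.HubbardSuperconductivity.HubbardSuperconductivity.Theorems

open Literature.MathematicalPhysics.QuantumLattice Literature.Barriers.HubbardSuperconductivity
  Literature.Probability.LatticeModels Matrix Finset HubbardWave0 WcbcsBoxTiling
open scoped BigOperators Matrix.Norms.L2Operator

/-! ### Relabelling covariance of the sourced partition function -/

section Relabel

variable {Λ Λ' : Type*} [LinearOrder Λ] [Fintype Λ] [LinearOrder Λ'] [Fintype Λ']

/-- **Covariance of the pair-sourced partition function under graph isomorphisms**: a site bijection carrying
adjacency to adjacency and weights to weights leaves `Z_β(H(G,w))` invariant. [folklore] -/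
theorem twR_partitionFn_sourced_relabel (G : SimpleGraph Λ) [DecidableRel G.Adj] (G' : SimpleGraph Λ') [DecidableRel G'.Adj]
    (f : Λ ≃ Λ') (hG : ∀ x y, G'.Adj (f x) (f y) ↔ G.Adj x y) (β t U μ h : ℝ) (w : Λ × Λ → ℂ) (w' : Λ' × Λ' → ℂ)
    (hw : ∀ x y, w' (f x, f y) = w (x, y)) :
    partitionFn β (hamiltonianWith G' t U μ - (h : ℂ) • ((∑ z : Λ' × Λ', w' z • bondPair z.1 z.2) + (∑ z : Λ' × Λ', w' z • bondPair z.1 z.2)ᴴ)) =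
      partitionFn β (hamiltonianWith G t U μ - (h : ℂ) • ((∑ z : Λ × Λ, w z • bondPair z.1 z.2) + (∑ z : Λ × Λ, w z • bondPair z.1 z.2)ᴴ)) := by
  rw [← partitionFn_relabel (Orb.mapEquiv f) β
    (hamiltonianWith G t U μ - (h : ℂ) • ((∑ z : Λ × Λ, w z • bondPair z.1 z.2) + (∑ z : Λ × Λ, w z • bondPair z.1 z.2)ᴴ))]
  congr 1
  have hP : relabel (Orb.mapEquiv f) (∑ z : Λ × Λ, w z • bondPair z.1 z.2) = ∑ z : Λ' × Λ', w' z • bondPair z.1 z.2 := by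
    rw [map_sum]
    refine Fintype.sum_equiv (f.prodCongr f) _ _ fun z => ?_
    -- `Γ_f b_{xy} Γ_f⁻¹ = b_{f x, f y}` (the tree's `dlsb_relabel_bondPair`, inlined to keep the import cone small)
    have hb : relabel (Orb.mapEquiv f) (bondPair z.1 z.2) = bondPair (f z.1) (f z.2) := by
      simp only [bondPair, map_sub, map_mul, relabel_annihilation, Orb.mapEquiv_orb]
    rw [map_smul, hb, Equiv.prodCongr_apply, Prod.map_apply, hw z.1 z.2]
  rw [map_sub, map_smul, map_add, relabel_conjTranspose, hP, relabel_hamiltonianWith G G' f hG]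

end Relabel

/-! ### Boundary sums are controlled by the number of adjacent pairs across the cut -/

section Boundary

variable {Λ Λ₁ Λ₂ : Type*} [LinearOrder Λ] [Fintype Λ] [LinearOrder Λ₁] [Fintype Λ₁] [LinearOrder Λ₂] [Fintype Λ₂]

omit [LinearOrder Λ] [Fintype Λ] in
/-- `‖c_b‖ = |t| · 1_{adjacent}` for the Hubbard couplings. [folklore] -/
theorem twR_norm_hubbardCoupling (G : SimpleGraph Λ) [DecidableRel G.Adj] (t : ℝ) (b : Bond Λ) :
    ‖hubbardCoupling G (t : ℂ) b‖ = |t| * (if G.Adj b.1 b.2.1 then 1 else 0) := by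
  rw [hubbardCoupling_apply]
  split_ifs <;> simp

/-- **Boundary sums**: for nearest-neighbour weights bounded by `1`, the two boundary sums of the two-block estimate are
at most `(2|t| + 4|h|)` times the number of ORDERED adjacent pairs not inside a block. [folklore] -/
theorem twR_boundary_sum_le (e₁ : Λ₁ ↪o Λ) (e₂ : Λ₂ ↪o Λ) (G : SimpleGraph Λ) [DecidableRel G.Adj] (t h : ℝ)
    (w : Λ × Λ → ℂ) (hw : ∀ z, ‖w z‖ ≤ if G.Adj z.1 z.2 then 1 else 0) :
    ∑ b ∈ ((Finset.univ : Finset (Bond Λ₁)).map ⟨bondMap e₁, bondMap_injective e₁⟩ ∪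
          (Finset.univ : Finset (Bond Λ₂)).map ⟨bondMap e₂, bondMap_injective e₂⟩)ᶜ, ‖hubbardCoupling G (t : ℂ) b‖ +
        4 * |h| * ∑ z ∈ ((Finset.univ : Finset (Λ₁ × Λ₁)).map ⟨Prod.map e₁ e₁, e₁.injective.prodMap e₁.injective⟩ ∪
          (Finset.univ : Finset (Λ₂ × Λ₂)).map ⟨Prod.map e₂ e₂, e₂.injective.prodMap e₂.injective⟩)ᶜ, ‖w z‖ ≤
      (2 * |t| + 4 * |h|) *
        ((((Finset.univ : Finset (Λ₁ × Λ₁)).map ⟨Prod.map e₁ e₁, e₁.injective.prodMap e₁.injective⟩ ∪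
          (Finset.univ : Finset (Λ₂ × Λ₂)).map ⟨Prod.map e₂ e₂, e₂.injective.prodMap e₂.injective⟩)ᶜ.filter
            (fun z => G.Adj z.1 z.2)).card : ℝ) := by
  set SB := ((Finset.univ : Finset (Bond Λ₁)).map ⟨bondMap e₁, bondMap_injective e₁⟩ ∪
    (Finset.univ : Finset (Bond Λ₂)).map ⟨bondMap e₂, bondMap_injective e₂⟩)ᶜ with hSB
  set SP := ((Finset.univ : Finset (Λ₁ × Λ₁)).map ⟨Prod.map e₁ e₁, e₁.injective.prodMap e₁.injective⟩ ∪
    (Finset.univ : Finset (Λ₂ × Λ₂)).map ⟨Prod.map e₂ e₂, e₂.injective.prodMap e₂.injective⟩)ᶜ with hSP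
  set N := (SP.filter fun z => G.Adj z.1 z.2).card with hN
  -- the pair sum
  have hP : ∑ z ∈ SP, ‖w z‖ ≤ (N : ℝ) := by
    calc ∑ z ∈ SP, ‖w z‖ ≤ ∑ z ∈ SP, (if G.Adj z.1 z.2 then (1 : ℝ) else 0) := Finset.sum_le_sum fun z _ => hw z
      _ = (N : ℝ) := by rw [Finset.sum_boole, hN]
  -- the bond sum: bonds not inside a block with adjacent ends inject into (pairs) × (spins)
  have hmem : ∀ b ∈ SB.filter (fun b : Bond Λ => G.Adj b.1 b.2.1),
      ((b.1, b.2.1), b.2.2) ∈ (SP.filter fun z => G.Adj z.1 z.2) ×ˢ (Finset.univ : Finset (Fin 2)) := by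
    intro b hb
    rw [Finset.mem_filter] at hb
    rw [Finset.mem_product, Finset.mem_filter]
    refine ⟨⟨?_, hb.2⟩, Finset.mem_univ _⟩
    rw [hSP, Finset.mem_compl, Finset.mem_union, not_or]
    have hb1 := hb.1
    rw [hSB, Finset.mem_compl, Finset.mem_union, not_or] at hb1
    constructor
    · intro hz
      obtain ⟨z, _, hz⟩ := Finset.mem_map.1 hz
      refine hb1.1 (Finset.mem_map.2 ⟨(z.1, z.2, b.2.2), Finset.mem_univ _, ?_⟩)
      simp only [Function.Embedding.coeFn_mk, Prod.map, Prod.mk.injEq] at hz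
      simp only [Function.Embedding.coeFn_mk, bondMap, hz.1, hz.2]
    · intro hz
      obtain ⟨z, _, hz⟩ := Finset.mem_map.1 hz
      refine hb1.2 (Finset.mem_map.2 ⟨(z.1, z.2, b.2.2), Finset.mem_univ _, ?_⟩)
      simp only [Function.Embedding.coeFn_mk, Prod.map, Prod.mk.injEq] at hz
      simp only [Function.Embedding.coeFn_mk, bondMap, hz.1, hz.2]
  have hinj : Set.InjOn (fun b : Bond Λ => ((b.1, b.2.1), b.2.2)) (SB.filter (fun b : Bond Λ => G.Adj b.1 b.2.1) : Set (Bond Λ)) := by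
    rintro ⟨x, y, σ⟩ _ ⟨x', y', σ'⟩ _ hbb
    simp only [Prod.mk.injEq] at hbb
    obtain ⟨⟨rfl, rfl⟩, rfl⟩ := hbb
    rfl
  have hcardB : ((SB.filter fun b : Bond Λ => G.Adj b.1 b.2.1).card : ℝ) ≤ 2 * N := by
    have h := Finset.card_le_card_of_injOn _ hmem hinj
    rw [Finset.card_product, Finset.card_univ, Fintype.card_fin] at h
    have h' : ((SB.filter fun b : Bond Λ => G.Adj b.1 b.2.1).card : ℝ) ≤ ((N * 2 : ℕ) : ℝ) := by exact_mod_cast h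
    push_cast at h'
    linarith
  have hB : ∑ b ∈ SB, ‖hubbardCoupling G (t : ℂ) b‖ ≤ |t| * (2 * N) := by
    calc ∑ b ∈ SB, ‖hubbardCoupling G (t : ℂ) b‖ = ∑ b ∈ SB, |t| * (if G.Adj b.1 b.2.1 then (1 : ℝ) else 0) :=
          Finset.sum_congr rfl fun b _ => twR_norm_hubbardCoupling G t b
      _ = |t| * ((SB.filter fun b : Bond Λ => G.Adj b.1 b.2.1).card : ℝ) := by rw [← Finset.mul_sum, Finset.sum_boole]
      _ ≤ |t| * (2 * N) := mul_le_mul_of_nonneg_left hcardB (abs_nonneg t)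
  have h4 : 0 ≤ 4 * |h| := by positivity
  nlinarith [hB, hP, mul_le_mul_of_nonneg_left hP h4, abs_nonneg t]

end Boundary

/-! ### Rectangles -/

section Rect

variable (ω : (Fin 2 → ℤ) → ℂ)

/-- The rectangle weights are nearest-neighbour weights bounded by `1`. [folklore] -/
theorem twR_rect_weight_le (hω₁ : ∀ v, ‖ω v‖ ≤ 1) (hωadj : ∀ a b : Fin 2 → ℤ, ω (b - a) ≠ 0 → (zdGraph 2).Adj a b) (m n : ℕ) (z : (Lex (Fin m × Fin n)) × (Lex (Fin m × Fin n))) :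
    ‖(fun z : (Lex (Fin m × Fin n)) × (Lex (Fin m × Fin n)) => ω (![((ofLex z.2).1 : ℤ), ((ofLex z.2).2 : ℤ)] - ![((ofLex z.1).1 : ℤ), ((ofLex z.1).2 : ℤ)])) z‖ ≤ if ((zdGraph 2).comap (fun p : (Lex (Fin m × Fin n)) => ![((ofLex p).1 : ℤ), ((ofLex p).2 : ℤ)])).Adj z.1 z.2 then 1 else 0 := by
  show ‖ω _‖ ≤ _
  split_ifs with hadj
  · exact hω₁ _
  · rw [SimpleGraph.comap_adj] at hadj
    have h0 : ω (![((ofLex z.2).1 : ℤ), ((ofLex z.2).2 : ℤ)] - ![((ofLex z.1).1 : ℤ), ((ofLex z.1).2 : ℤ)]) = 0 := by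
      by_contra hne
      exact hadj (hωadj _ _ hne)
    rw [h0, norm_zero]

/-- The number of ordered adjacent pairs of the `m × n` rectangle is at most `4mn`. [folklore] -/
theorem twR_rect_card_adj_le (m n : ℕ) :
    ((Finset.univ : Finset ((Lex (Fin m × Fin n)) × (Lex (Fin m × Fin n)))).filter (fun z => ((zdGraph 2).comap (fun p : (Lex (Fin m × Fin n)) => ![((ofLex p).1 : ℤ), ((ofLex p).2 : ℤ)])).Adj z.1 z.2)).card ≤ 4 * (m * n) := by
  rw [Finset.card_filter, Fintype.sum_prod_type]
  calc ∑ p : (Lex (Fin m × Fin n)), ∑ q : (Lex (Fin m × Fin n)), (if ((zdGraph 2).comap (fun p : (Lex (Fin m × Fin n)) => ![((ofLex p).1 : ℤ), ((ofLex p).2 : ℤ)])).Adj (p, q).1 (p, q).2 then 1 else 0)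
      ≤ ∑ _p : (Lex (Fin m × Fin n)), 4 := Finset.sum_le_sum fun p _ => by
        rw [← Finset.card_filter]
        exact card_filter_rect_adj_le p
    _ = 4 * (m * n) := by rw [Finset.sum_const, Finset.card_univ, card_rect, smul_eq_mul, mul_comm]

/-- **Volume bound for sourced rectangles**: `|log Z_β(m,n) - mn·log z₀| ≤ 4βmn(2|t| + 4|h|)`. [folklore] -/
theorem twR_rect_abs_log_sub_le (hω₁ : ∀ v, ‖ω v‖ ≤ 1) (hωadj : ∀ a b : Fin 2 → ℤ, ω (b - a) ≠ 0 → (zdGraph 2).Adj a b) (m n : ℕ) {β : ℝ} (hβ : 0 ≤ β) (t U μ h : ℝ) :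
    |Real.log (partitionFn β (hamiltonianWith ((zdGraph 2).comap (fun p : (Lex (Fin m × Fin n)) => ![((ofLex p).1 : ℤ), ((ofLex p).2 : ℤ)])) t U μ - (h : ℂ) • ((∑ z : (Lex (Fin m × Fin n)) × (Lex (Fin m × Fin n)), (fun z : (Lex (Fin m × Fin n)) × (Lex (Fin m × Fin n)) => ω (![((ofLex z.2).1 : ℤ), ((ofLex z.2).2 : ℤ)] - ![((ofLex z.1).1 : ℤ), ((ofLex z.1).2 : ℤ)])) z • bondPair z.1 z.2) + (∑ z : (Lex (Fin m × Fin n)) × (Lex (Fin m × Fin n)), (fun z : (Lex (Fin m × Fin n)) × (Lex (Fin m × Fin n)) => ω (![((ofLex z.2).1 : ℤ), ((ofLex z.2).2 : ℤ)] - ![((ofLex z.1).1 : ℤ), ((ofLex z.1).2 : ℤ)])) z • bondPair z.1 z.2)ᴴ))).re - (m * n : ℕ) * Real.log (atomicPartitionFnReal β U μ)| ≤ β * ((2 * |t| + 4 * |h|) * (4 * (m * n : ℕ))) := by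
  have key := twR_abs_log_partitionFn_sub_card_mul_log_le ((zdGraph 2).comap (fun p : (Lex (Fin m × Fin n)) => ![((ofLex p).1 : ℤ), ((ofLex p).2 : ℤ)])) hβ t U μ h (fun z : (Lex (Fin m × Fin n)) × (Lex (Fin m × Fin n)) => ω (![((ofLex z.2).1 : ℤ), ((ofLex z.2).2 : ℤ)] - ![((ofLex z.1).1 : ℤ), ((ofLex z.1).2 : ℤ)]))
  rw [card_rect] at key
  refine key.trans (mul_le_mul_of_nonneg_left ?_ hβ)
  -- both sums are controlled by the number of ordered adjacent pairs (boundary lemma with two EMPTY blocks)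
  have hb := twR_boundary_sum_le (OrderEmbedding.ofIsEmpty : Fin 0 ↪o (Lex (Fin m × Fin n)))
    (OrderEmbedding.ofIsEmpty : Fin 0 ↪o (Lex (Fin m × Fin n))) ((zdGraph 2).comap (fun p : (Lex (Fin m × Fin n)) => ![((ofLex p).1 : ℤ), ((ofLex p).2 : ℤ)])) t h (fun z : (Lex (Fin m × Fin n)) × (Lex (Fin m × Fin n)) => ω (![((ofLex z.2).1 : ℤ), ((ofLex z.2).2 : ℤ)] - ![((ofLex z.1).1 : ℤ), ((ofLex z.1).2 : ℤ)])) (twR_rect_weight_le ω hω₁ hωadj m n)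
  simp only [Finset.univ_eq_empty, Finset.map_empty, Finset.empty_union, Finset.compl_empty] at hb
  refine hb.trans (mul_le_mul_of_nonneg_left ?_ (by positivity))
  exact_mod_cast twR_rect_card_adj_le m n

/-- Coordinate bookkeeping for translations: `(s+a, b) - (s+c, d) = (a,b) - (c,d)`. [folklore] -/
theorem twR_shift_vec_sub (s a b c d : ℤ) : ![s + a, b] - ![s + c, d] = ![a, b] - ![c, d] := by
  ext i
  fin_cases i <;> simp

/-- Coordinate bookkeeping for transposition: `swap((b,a) - (d,c)) = (a,b) - (c,d)`. [folklore] -/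
theorem twR_swap_vec_sub (a b c d : ℤ) :
    (fun v : Fin 2 → ℤ => ![v 1, v 0]) (![b, a] - ![d, c]) = ![a, b] - ![c, d] := by
  ext i
  fin_cases i <;> simp

/-- **Transposition**: `Z_β` of the `n × m` rectangle with the swapped kernel `ω ∘ swap` equals `Z_β` of the `m × n`
rectangle with kernel `ω` (`(i,j) ↦ (j,i)` is a graph isomorphism; tree `relabel`). [folklore] -/
theorem twR_rect_partitionFn_transpose (m n : ℕ) (β t U μ h : ℝ) :
    partitionFn β (hamiltonianWith ((zdGraph 2).comap (fun p : (Lex (Fin n × Fin m)) => ![((ofLex p).1 : ℤ), ((ofLex p).2 : ℤ)])) t U μ - (h : ℂ) • ((∑ z : (Lex (Fin n × Fin m)) × (Lex (Fin n × Fin m)), (fun z : (Lex (Fin n × Fin m)) × (Lex (Fin n × Fin m)) => (ω ∘ (fun v : Fin 2 → ℤ => ![v 1, v 0])) (![((ofLex z.2).1 : ℤ), ((ofLex z.2).2 : ℤ)] - ![((ofLex z.1).1 : ℤ), ((ofLex z.1).2 : ℤ)])) z • bondPair z.1 z.2) + (∑ z : (Lex (Fin n × Fin m)) × (Lex (Fin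 n × Fin m)), (fun z : (Lex (Fin n × Fin m)) × (Lex (Fin n × Fin m)) => (ω ∘ (fun v : Fin 2 → ℤ => ![v 1, v 0])) (![((ofLex z.2).1 : ℤ), ((ofLex z.2).2 : ℤ)] - ![((ofLex z.1).1 : ℤ), ((ofLex z.1).2 : ℤ)])) z • bondPair z.1 z.2)ᴴ)) = partitionFn β (hamiltonianWith ((zdGraph 2).comap (fun p : (Lex (Fin m × Fin n)) => ![((ofLex p).1 : ℤ), ((ofLex p).2 : ℤ)])) t U μ - (h : ℂ) • ((∑ z : (Lex (Fin m × Fin n)) × (Lex (Fin m × Fin n)), (fun z : (Lex (Fin m × Fin n)) × (Lex (Fin m × Fin n)) => ω (![((ofLex z.2).1 : ℤ), ((ofLex z.2).2 : ℤ)] - ![((ofLex z.1).1 : ℤ), ((ofLex z.1).2 : ℤ)])) z • bondPair z.1 z.2) + (∑ z : (Lex (Fin m × Fin n)) × (Lex (Fin m × Fin n)), (fun z : (Lex (Fin m × Fin n)) × (Lex (Fin m × Fin n)) => ω (![((ofLex z.2).1 : ℤ), ((ofLex z.2).2 : ℤ)] - ![((ofLex z.1).1 : ℤ), ((ofLex z.1).2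 : ℤ)])) z • bondPair z.1 z.2)ᴴ)) := by
  refine twR_partitionFn_sourced_relabel ((zdGraph 2).comap (fun p : (Lex (Fin m × Fin n)) => ![((ofLex p).1 : ℤ), ((ofLex p).2 : ℤ)])) ((zdGraph 2).comap (fun p : (Lex (Fin n × Fin m)) => ![((ofLex p).1 : ℤ), ((ofLex p).2 : ℤ)])) (ofLex.trans ((Equiv.prodComm (Fin m) (Fin n)).trans toLex))
    (fun x y => ?_) β t U μ h (fun z : (Lex (Fin m × Fin n)) × (Lex (Fin m × Fin n)) => ω (![((ofLex z.2).1 : ℤ), ((ofLex z.2).2 : ℤ)] - ![((ofLex z.1).1 : ℤ), ((ofLex z.1).2 : ℤ)])) (fun z : (Lex (Fin n × Fin m)) × (Lex (Fin n × Fin m)) => (ω ∘ (fun v : Fin 2 → ℤ => ![v 1, v 0])) (![((ofLex z.2).1 : ℤ), ((ofLex z.2).2 : ℤ)] - ![((ofLex z.1).1 : ℤ), ((ofLex z.1).2 : ℤ)])) (fun x y => ?_)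
  · rw [rect_adj_iff, rect_adj_iff]
    simp only [Equiv.trans_apply, Equiv.prodComm_apply, ofLex_toLex, Prod.fst_swap, Prod.snd_swap]
    tauto
  · simp only [Equiv.trans_apply, Equiv.prodComm_apply, ofLex_toLex, Prod.fst_swap, Prod.snd_swap, Function.comp_apply,
      twR_swap_vec_sub]

/-- Sites of the stacked rectangle below the cut come from the lower block. [folklore] -/
theorem twR_rect_exists_low {m₁ m₂ n : ℕ} (p : (Lex (Fin (m₁ + m₂) × Fin n))) (hp : ((ofLex p).1 : ℕ) < m₁) :
    ∃ x : (Lex (Fin m₁ × Fin n)), toLex (Fin.castAdd m₂ (ofLex x).1, (ofLex x).2) = p :=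
  ⟨toLex (⟨(ofLex p).1, hp⟩, (ofLex p).2), rect_ext (by simp) (by simp)⟩

/-- Sites of the stacked rectangle above the cut come from the upper block. [folklore] -/
theorem twR_rect_exists_high {m₁ m₂ n : ℕ} (p : (Lex (Fin (m₁ + m₂) × Fin n))) (hp : m₁ ≤ ((ofLex p).1 : ℕ)) :
    ∃ y : (Lex (Fin m₂ × Fin n)), toLex (Fin.natAdd m₁ (ofLex y).1, (ofLex y).2) = p := by
  have hlt := ((ofLex p).1).isLt
  refine ⟨toLex (⟨(ofLex p).1 - m₁, by omega⟩, (ofLex p).2), rect_ext ?_ (by simp)⟩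
  simp only [ofLex_toLex, Fin.val_natAdd]
  omega

/-- The lower-block embedding is strictly monotone for the row-major orders. [folklore] -/
theorem twR_rect_low_strictMono (m₁ m₂ n : ℕ) :
    StrictMono (fun x : (Lex (Fin m₁ × Fin n)) => (toLex (Fin.castAdd m₂ (ofLex x).1, (ofLex x).2) : (Lex (Fin (m₁ + m₂) × Fin n)))) := by
  intro p p' hlt
  rw [Prod.Lex.lt_iff] at hlt ⊢
  simp only [ofLex_toLex, Fin.lt_def, Fin.ext_iff, Fin.val_castAdd] at hlt ⊢
  exact hlt

/-- The upper-block embedding is strictly monotone for the row-major orders. [folklore] -/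
theorem twR_rect_high_strictMono (m₁ m₂ n : ℕ) :
    StrictMono (fun y : (Lex (Fin m₂ × Fin n)) => (toLex (Fin.natAdd m₁ (ofLex y).1, (ofLex y).2) : (Lex (Fin (m₁ + m₂) × Fin n)))) := by
  intro q q' hlt
  rw [Prod.Lex.lt_iff] at hlt ⊢
  simp only [ofLex_toLex, Fin.lt_def, Fin.ext_iff, Fin.val_natAdd] at hlt ⊢
  omega

/-- **Row cut**: `|log Z_β(m₁+m₂, n) - (log Z_β(m₁, n) + log Z_β(m₂, n))| ≤ β(2|t| + 4|h|)·2n`. [folklore] -/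
theorem twR_rect_rowCut (hω₁ : ∀ v, ‖ω v‖ ≤ 1) (hωadj : ∀ a b : Fin 2 → ℤ, ω (b - a) ≠ 0 → (zdGraph 2).Adj a b) {m₁ m₂ m : ℕ} (hm : m₁ + m₂ = m) (n : ℕ) {β : ℝ} (hβ : 0 ≤ β) (t U μ h : ℝ) :
    |Real.log (partitionFn β (hamiltonianWith ((zdGraph 2).comap (fun p : (Lex (Fin m × Fin n)) => ![((ofLex p).1 : ℤ), ((ofLex p).2 : ℤ)])) t U μ - (h : ℂ) • ((∑ z : (Lex (Fin m × Fin n)) × (Lex (Fin m × Fin n)), (fun z : (Lex (Fin m × Fin n)) × (Lex (Fin m × Fin n)) => ω (![((ofLex z.2).1 : ℤ), ((ofLex z.2).2 : ℤ)] - ![((ofLex z.1).1 : ℤ), ((ofLex z.1).2 : ℤ)])) z • bondPair z.1 z.2) + (∑ z : (Lex (Fin m × Fin n)) × (Lex (Fin m × Fin n)), (fun z : (Lex (Fin m × Fin n)) × (Lex (Fin m × Fin n)) => ω (![((ofLex z.2).1 : ℤ), ((ofLex z.2).2 : ℤ)] - ![((ofLex z.1).1 : ℤ), ((ofLex z.1).2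 : ℤ)])) z • bondPair z.1 z.2)ᴴ))).re - (Real.log (partitionFn β (hamiltonianWith ((zdGraph 2).comap (fun p : (Lex (Fin m₁ × Fin n)) => ![((ofLex p).1 : ℤ), ((ofLex p).2 : ℤ)])) t U μ - (h : ℂ) • ((∑ z : (Lex (Fin m₁ × Fin n)) × (Lex (Fin m₁ × Fin n)), (fun z : (Lex (Fin m₁ × Fin n)) × (Lex (Fin m₁ × Fin n)) => ω (![((ofLex z.2).1 : ℤ), ((ofLex z.2).2 : ℤ)] - ![((ofLex z.1).1 : ℤ), ((ofLex z.1).2 : ℤ)])) z • bondPair z.1 z.2) + (∑ z : (Lex (Fin m₁ × Fin n)) × (Lex (Fin m₁ × Fin n)), (fun z : (Lex (Fin m₁ × Fin n)) × (Lex (Fin m₁ × Fin n)) => ω (![((ofLex z.2).1 : ℤ), ((ofLex z.2).2 : ℤ)] - ![((ofLex z.1).1 : ℤ), ((ofLex z.1).2 : ℤ)])) z • bondPair z.1 z.2)ᴴ))).re + Real.log (partitionFn β (hamiltonianWith ((zdGraph 2).comap (fun p : (Lex (Fin m₂ × Fin n)) => ![((ofLex p).1 : ℤ), ((ofLex p).2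 : ℤ)])) t U μ - (h : ℂ) • ((∑ z : (Lex (Fin m₂ × Fin n)) × (Lex (Fin m₂ × Fin n)), (fun z : (Lex (Fin m₂ × Fin n)) × (Lex (Fin m₂ × Fin n)) => ω (![((ofLex z.2).1 : ℤ), ((ofLex z.2).2 : ℤ)] - ![((ofLex z.1).1 : ℤ), ((ofLex z.1).2 : ℤ)])) z • bondPair z.1 z.2) + (∑ z : (Lex (Fin m₂ × Fin n)) × (Lex (Fin m₂ × Fin n)), (fun z : (Lex (Fin m₂ × Fin n)) × (Lex (Fin m₂ × Fin n)) => ω (![((ofLex z.2).1 : ℤ), ((ofLex z.2).2 : ℤ)] - ![((ofLex z.1).1 : ℤ), ((ofLex z.1).2 : ℤ)])) z • bondPair z.1 z.2)ᴴ))).re)| ≤ β * ((2 * |t| + 4 * |h|) * (2 * n)) := by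
  subst hm
  set e₁ : (Lex (Fin m₁ × Fin n)) ↪o (Lex (Fin (m₁ + m₂) × Fin n)) := OrderEmbedding.ofStrictMono _ (twR_rect_low_strictMono m₁ m₂ n) with he₁
  set e₂ : (Lex (Fin m₂ × Fin n)) ↪o (Lex (Fin (m₁ + m₂) × Fin n)) := OrderEmbedding.ofStrictMono _ (twR_rect_high_strictMono m₁ m₂ n) with he₂
  have he₁a : ∀ x, e₁ x = toLex (Fin.castAdd m₂ (ofLex x).1, (ofLex x).2) := fun x => rfl
  have he₂a : ∀ y, e₂ y = toLex (Fin.natAdd m₁ (ofLex y).1, (ofLex y).2) := fun y => rfl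
  have hne : ∀ x y, e₁ x ≠ e₂ y := by
    intro x y hxy
    have h1 := congrArg (fun p => ((ofLex p).1 : ℕ)) hxy
    simp only [he₁a, he₂a, ofLex_toLex, Fin.val_castAdd, Fin.val_natAdd] at h1
    have := ((ofLex x).1).isLt
    omega
  have hcard : Fintype.card (Lex (Fin m₁ × Fin n)) + Fintype.card (Lex (Fin m₂ × Fin n)) = Fintype.card (Lex (Fin (m₁ + m₂) × Fin n)) := by
    rw [card_rect, card_rect, card_rect]; ring
  have hG₁ : ∀ x y, ((zdGraph 2).comap (fun p : (Lex (Fin m₁ × Fin n)) => ![((ofLex p).1 : ℤ), ((ofLex p).2 : ℤ)])).Adj x y ↔ ((zdGraph 2).comap (fun p : (Lex (Fin (m₁ + m₂) × Fin n)) => ![((ofLex p).1 : ℤ), ((ofLex p).2 : ℤ)])).Adj (e₁ x) (e₁ y) := by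
    intro x y
    rw [rect_adj_iff, rect_adj_iff]
    simp only [he₁a, ofLex_toLex, Fin.val_castAdd]
  have hG₂ : ∀ x y, ((zdGraph 2).comap (fun p : (Lex (Fin m₂ × Fin n)) => ![((ofLex p).1 : ℤ), ((ofLex p).2 : ℤ)])).Adj x y ↔ ((zdGraph 2).comap (fun p : (Lex (Fin (m₁ + m₂) × Fin n)) => ![((ofLex p).1 : ℤ), ((ofLex p).2 : ℤ)])).Adj (e₂ x) (e₂ y) := by
    intro x y
    rw [rect_adj_iff, rect_adj_iff]
    simp only [he₂a, ofLex_toLex, Fin.val_natAdd]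
    omega
  have hw₁ : ∀ z, (fun z : (Lex (Fin m₁ × Fin n)) × (Lex (Fin m₁ × Fin n)) => ω (![((ofLex z.2).1 : ℤ), ((ofLex z.2).2 : ℤ)] - ![((ofLex z.1).1 : ℤ), ((ofLex z.1).2 : ℤ)])) z = (fun z : (Lex (Fin (m₁ + m₂) × Fin n)) × (Lex (Fin (m₁ + m₂) × Fin n)) => ω (![((ofLex z.2).1 : ℤ), ((ofLex z.2).2 : ℤ)] - ![((ofLex z.1).1 : ℤ), ((ofLex z.1).2 : ℤ)])) (Prod.map e₁ e₁ z) := by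
    intro z
    simp only [Prod.map, he₁a, ofLex_toLex, Fin.val_castAdd]
  have hw₂ : ∀ z, (fun z : (Lex (Fin m₂ × Fin n)) × (Lex (Fin m₂ × Fin n)) => ω (![((ofLex z.2).1 : ℤ), ((ofLex z.2).2 : ℤ)] - ![((ofLex z.1).1 : ℤ), ((ofLex z.1).2 : ℤ)])) z = (fun z : (Lex (Fin (m₁ + m₂) × Fin n)) × (Lex (Fin (m₁ + m₂) × Fin n)) => ω (![((ofLex z.2).1 : ℤ), ((ofLex z.2).2 : ℤ)] - ![((ofLex z.1).1 : ℤ), ((ofLex z.1).2 : ℤ)])) (Prod.map e₂ e₂ z) := by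
    intro z
    simp only [Prod.map, he₂a, ofLex_toLex, Fin.val_natAdd, Nat.cast_add]
    rw [twR_shift_vec_sub]
  have key := twR_abs_log_partitionFn_sourced_cut_le e₁ e₂ hne hcard ((zdGraph 2).comap (fun p : (Lex (Fin (m₁ + m₂) × Fin n)) => ![((ofLex p).1 : ℤ), ((ofLex p).2 : ℤ)])) ((zdGraph 2).comap (fun p : (Lex (Fin m₁ × Fin n)) => ![((ofLex p).1 : ℤ), ((ofLex p).2 : ℤ)])) ((zdGraph 2).comap (fun p : (Lex (Fin m₂ × Fin n)) => ![((ofLex p).1 : ℤ), ((ofLex p).2 : ℤ)])) hG₁ hG₂ hβ t U μ h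
    (fun z : (Lex (Fin (m₁ + m₂) × Fin n)) × (Lex (Fin (m₁ + m₂) × Fin n)) => ω (![((ofLex z.2).1 : ℤ), ((ofLex z.2).2 : ℤ)] - ![((ofLex z.1).1 : ℤ), ((ofLex z.1).2 : ℤ)])) (fun z : (Lex (Fin m₁ × Fin n)) × (Lex (Fin m₁ × Fin n)) => ω (![((ofLex z.2).1 : ℤ), ((ofLex z.2).2 : ℤ)] - ![((ofLex z.1).1 : ℤ), ((ofLex z.1).2 : ℤ)])) (fun z : (Lex (Fin m₂ × Fin n)) × (Lex (Fin m₂ × Fin n)) => ω (![((ofLex z.2).1 : ℤ), ((ofLex z.2).2 : ℤ)] - ![((ofLex z.1).1 : ℤ), ((ofLex z.1).2 : ℤ)])) hw₁ hw₂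
  refine key.trans (mul_le_mul_of_nonneg_left ((twR_boundary_sum_le e₁ e₂ ((zdGraph 2).comap (fun p : (Lex (Fin (m₁ + m₂) × Fin n)) => ![((ofLex p).1 : ℤ), ((ofLex p).2 : ℤ)])) t h (fun z : (Lex (Fin (m₁ + m₂) × Fin n)) × (Lex (Fin (m₁ + m₂) × Fin n)) => ω (![((ofLex z.2).1 : ℤ), ((ofLex z.2).2 : ℤ)] - ![((ofLex z.1).1 : ℤ), ((ofLex z.1).2 : ℤ)]))
    (twR_rect_weight_le ω hω₁ hωadj (m₁ + m₂) n)).trans (mul_le_mul_of_nonneg_left ?_ (by positivity))) hβ)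
  -- the adjacent pairs across the cut inject into `Fin n × Bool`
  set SP := (((Finset.univ : Finset ((Lex (Fin m₁ × Fin n)) × (Lex (Fin m₁ × Fin n)))).map ⟨Prod.map e₁ e₁, e₁.injective.prodMap e₁.injective⟩ ∪
    (Finset.univ : Finset ((Lex (Fin m₂ × Fin n)) × (Lex (Fin m₂ × Fin n)))).map ⟨Prod.map e₂ e₂, e₂.injective.prodMap e₂.injective⟩)ᶜ.filter
      (fun z => ((zdGraph 2).comap (fun p : (Lex (Fin (m₁ + m₂) × Fin n)) => ![((ofLex p).1 : ℤ), ((ofLex p).2 : ℤ)])).Adj z.1 z.2)) with hSP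
  have hchar : ∀ z ∈ SP, ((((ofLex z.1).1 : ℕ) + 1 = m₁ ∧ ((ofLex z.2).1 : ℕ) = m₁) ∨
      (((ofLex z.1).1 : ℕ) = m₁ ∧ ((ofLex z.2).1 : ℕ) + 1 = m₁)) ∧ ((ofLex z.1).2 : ℕ) = (ofLex z.2).2 := by
    intro z hz
    rw [hSP, Finset.mem_filter, Finset.mem_compl, Finset.mem_union, not_or] at hz
    obtain ⟨⟨h1, h2⟩, hadj⟩ := hz
    rw [rect_adj_iff] at hadj
    have n1 : ¬ (((ofLex z.1).1 : ℕ) < m₁ ∧ ((ofLex z.2).1 : ℕ) < m₁) := by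
      rintro ⟨ha, hb⟩
      obtain ⟨x, hx⟩ := twR_rect_exists_low (m₂ := m₂) z.1 ha
      obtain ⟨y, hy⟩ := twR_rect_exists_low (m₂ := m₂) z.2 hb
      exact h1 (Finset.mem_map.2 ⟨(x, y), Finset.mem_univ _, Prod.ext hx hy⟩)
    have n2 : ¬ (m₁ ≤ ((ofLex z.1).1 : ℕ) ∧ m₁ ≤ ((ofLex z.2).1 : ℕ)) := by
      rintro ⟨ha, hb⟩
      obtain ⟨x, hx⟩ := twR_rect_exists_high (m₂ := m₂) z.1 ha
      obtain ⟨y, hy⟩ := twR_rect_exists_high (m₂ := m₂) z.2 hb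
      exact h2 (Finset.mem_map.2 ⟨(x, y), Finset.mem_univ _, Prod.ext hx hy⟩)
    omega
  have hmaps : ∀ z ∈ SP, (((ofLex z.1).2 : ℕ), decide (((ofLex z.1).1 : ℕ) < m₁)) ∈ (Finset.range n) ×ˢ (Finset.univ : Finset Bool) := by
    intro z _
    rw [Finset.mem_product, Finset.mem_range]
    exact ⟨((ofLex z.1).2).isLt, Finset.mem_univ _⟩
  have hinj : Set.InjOn (fun z : (Lex (Fin (m₁ + m₂) × Fin n)) × (Lex (Fin (m₁ + m₂) × Fin n)) => (((ofLex z.1).2 : ℕ), decide (((ofLex z.1).1 : ℕ) < m₁)))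
      (SP : Set ((Lex (Fin (m₁ + m₂) × Fin n)) × (Lex (Fin (m₁ + m₂) × Fin n)))) := by
    intro z hz z' hz' hzz
    have hc := hchar z hz
    have hc' := hchar z' hz'
    simp only [Prod.mk.injEq, decide_eq_decide] at hzz
    refine Prod.ext (rect_ext ?_ ?_) (rect_ext ?_ ?_) <;> omega
  have hle := Finset.card_le_card_of_injOn _ hmaps hinj
  rw [Finset.card_product, Finset.card_range, Finset.card_univ, Fintype.card_bool] at hle
  have hle' : SP.card ≤ 2 * n := by omega
  exact_mod_cast hle'

/-- **Column cut** (row cut of the transposed rectangles with the swapped kernel):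
`|log Z_β(m, n₁+n₂) - (log Z_β(m, n₁) + log Z_β(m, n₂))| ≤ β(2|t| + 4|h|)·2m`. [folklore] -/
theorem twR_rect_colCut (hω₁ : ∀ v, ‖ω v‖ ≤ 1) (hωadj : ∀ a b : Fin 2 → ℤ, ω (b - a) ≠ 0 → (zdGraph 2).Adj a b) (m : ℕ) {n₁ n₂ n : ℕ} (hn : n₁ + n₂ = n) {β : ℝ} (hβ : 0 ≤ β) (t U μ h : ℝ) :
    |Real.log (partitionFn β (hamiltonianWith ((zdGraph 2).comap (fun p : (Lex (Fin m × Fin n)) => ![((ofLex p).1 : ℤ), ((ofLex p).2 : ℤ)])) t U μ - (h : ℂ) • ((∑ z : (Lex (Fin m × Fin n)) × (Lex (Fin m × Fin n)), (fun z : (Lex (Fin m × Fin n)) × (Lex (Fin m × Fin n)) => ω (![((ofLex z.2).1 : ℤ), ((ofLex z.2).2 : ℤ)] - ![((ofLex z.1).1 : ℤ), ((ofLex z.1).2 : ℤ)])) z • bondPair z.1 z.2) + (∑ z : (Lex (Fin m × Fin n)) × (Lex (Fin m × Fin n)), (fun z : (Lex (Fin m × Fin n)) × (Lex (Fin m ×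 Fin n)) => ω (![((ofLex z.2).1 : ℤ), ((ofLex z.2).2 : ℤ)] - ![((ofLex z.1).1 : ℤ), ((ofLex z.1).2 : ℤ)])) z • bondPair z.1 z.2)ᴴ))).re - (Real.log (partitionFn β (hamiltonianWith ((zdGraph 2).comap (fun p : (Lex (Fin m × Fin n₁)) => ![((ofLex p).1 : ℤ), ((ofLex p).2 : ℤ)])) t U μ - (h : ℂ) • ((∑ z : (Lex (Fin m × Fin n₁)) × (Lex (Fin m × Fin n₁)), (fun z : (Lex (Fin m × Fin n₁)) × (Lex (Fin m × Fin n₁)) => ω (![((ofLex z.2).1 : ℤ), ((ofLex z.2).2 : ℤ)] - ![((ofLex z.1).1 : ℤ), ((ofLex z.1).2 : ℤ)])) z • bondPair z.1 z.2) + (∑ z : (Lex (Fin m × Fin n₁)) × (Lex (Fin m × Fin n₁)), (fun z : (Lex (Fin m × Fin n₁)) × (Lex (Fin m × Fin n₁)) => ω (![((ofLex z.2).1 : ℤ), ((ofLex z.2).2 : ℤ)] - ![((ofLex z.1).1 : ℤ), ((ofLex z.1).2 : ℤ)])) z • bondPair z.1 z.2)ᴴ))).re + Real.log (partitionFn β (hamiltonianWith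 ((zdGraph 2).comap (fun p : (Lex (Fin m × Fin n₂)) => ![((ofLex p).1 : ℤ), ((ofLex p).2 : ℤ)])) t U μ - (h : ℂ) • ((∑ z : (Lex (Fin m × Fin n₂)) × (Lex (Fin m × Fin n₂)), (fun z : (Lex (Fin m × Fin n₂)) × (Lex (Fin m × Fin n₂)) => ω (![((ofLex z.2).1 : ℤ), ((ofLex z.2).2 : ℤ)] - ![((ofLex z.1).1 : ℤ), ((ofLex z.1).2 : ℤ)])) z • bondPair z.1 z.2) + (∑ z : (Lex (Fin m × Fin n₂)) × (Lex (Fin m × Fin n₂)), (fun z : (Lex (Fin m × Fin n₂)) × (Lex (Fin m × Fin n₂)) => ω (![((ofLex z.2).1 : ℤ), ((ofLex z.2).2 : ℤ)] - ![((ofLex z.1).1 : ℤ), ((ofLex z.1).2 : ℤ)])) z • bondPair z.1 z.2)ᴴ))).re)| ≤ β * ((2 * |t| + 4 * |h|) * (2 * m)) := by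
  have hS₁ : ∀ v, ‖(ω ∘ (fun v : Fin 2 → ℤ => ![v 1, v 0])) v‖ ≤ 1 := fun v => hω₁ _
  have hSadj : ∀ a b : Fin 2 → ℤ, (ω ∘ (fun v : Fin 2 → ℤ => ![v 1, v 0])) (b - a) ≠ 0 → (zdGraph 2).Adj a b := by
    intro a b hab
    have hv : ![b 1, b 0] - ![a 1, a 0] = (fun v : Fin 2 → ℤ => ![v 1, v 0]) (b - a) := by
      ext i; fin_cases i <;> simp
    have h := hωadj ![a 1, a 0] ![b 1, b 0] (by rw [hv]; exact hab)
    have ha : a = ![a 0, a 1] := by ext i; fin_cases i <;> rfl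
    have hb : b = ![b 0, b 1] := by ext i; fin_cases i <;> rfl
    rw [zdGraph_two_adj_iff] at h
    rw [ha, hb, zdGraph_two_adj_iff]
    omega
  have key := twR_rect_rowCut (ω ∘ (fun v : Fin 2 → ℤ => ![v 1, v 0])) hS₁ hSadj hn m hβ t U μ h
  rw [← twR_rect_partitionFn_transpose ω m n, ← twR_rect_partitionFn_transpose ω m n₁,
    ← twR_rect_partitionFn_transpose ω m n₂]
  exact key

end Rect

/-! ### Summary (registered sub-goal of stmt-HubbardSuperconductivity-15581) -/

/-- **Registered sub-goal `twR_rectRowCut`** (infrastructure for `stub_sourcedPressureLimit`): the row cut for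
pair-sourced Hubbard rectangles with a nearest-neighbour kernel. [folklore] -/
theorem twR_rectRowCut : ∀ (ω : (Fin 2 → ℤ) → ℂ), (∀ v, ‖ω v‖ ≤ 1) → (∀ a b : Fin 2 → ℤ, ω (b - a) ≠ 0 → (Literature.Probability.LatticeModels.zdGraph 2).Adj a b) → ∀ (m₁ m₂ n : ℕ) (β t U μ h : ℝ), 0 ≤ β → |Real.log (Matrix.partitionFn β (hamiltonianWith ((Literature.Probability.LatticeModels.zdGraph 2).comap (fun p : (Lex (Fin (m₁ + m₂) × Fin n)) => ![((ofLex p).1 : ℤ), ((ofLex p).2 : ℤ)])) t U μ - (h : ℂ) • ((∑ z : (Lex (Fin (m₁ + m₂) × Fin n)) × (Lex (Fin (m₁ + m₂) × Fin n)), (fun z : (Lex (Fin (m₁ + m₂) × Fin n)) × (Lex (Fin (m₁ + m₂) × Fin n)) => ω (![((ofLex z.2).1 : ℤ), ((ofLex z.2).2 : ℤ)] - ![((ofLex z.1).1 : ℤ), ((ofLex z.1).2 : ℤ)])) z • Literature.Barriers.HubbardSuperconductivity.bondPair z.1 z.2) + (∑ z : (Lex (Fin (m₁ + m₂) × Fin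 n)) × (Lex (Fin (m₁ + m₂) × Fin n)), (fun z : (Lex (Fin (m₁ + m₂) × Fin n)) × (Lex (Fin (m₁ + m₂) × Fin n)) => ω (![((ofLex z.2).1 : ℤ), ((ofLex z.2).2 : ℤ)] - ![((ofLex z.1).1 : ℤ), ((ofLex z.1).2 : ℤ)])) z • Literature.Barriers.HubbardSuperconductivity.bondPair z.1 z.2)ᴴ))).re - (Real.log (Matrix.partitionFn β (hamiltonianWith ((Literature.Probability.LatticeModels.zdGraph 2).comap (fun p : (Lex (Fin m₁ × Fin n)) => ![((ofLex p).1 : ℤ), ((ofLex p).2 : ℤ)])) t U μ - (h : ℂ) • ((∑ z : (Lex (Fin m₁ × Fin n)) × (Lex (Fin m₁ × Fin n)), (fun z : (Lex (Fin m₁ × Fin n)) × (Lex (Fin m₁ × Fin n)) => ω (![((ofLex z.2).1 : ℤ), ((ofLex z.2).2 : ℤ)] - ![((ofLex z.1).1 : ℤ), ((ofLex z.1).2 : ℤ)])) z • Literature.Barriers.HubbardSuperconductivity.bondPair z.1 z.2) + (∑ z : (Lex (Fin m₁ × Fin n)) × (Lex (Fin m₁ × Fin n)), (fun z : (Lex (Fin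 m₁ × Fin n)) × (Lex (Fin m₁ × Fin n)) => ω (![((ofLex z.2).1 : ℤ), ((ofLex z.2).2 : ℤ)] - ![((ofLex z.1).1 : ℤ), ((ofLex z.1).2 : ℤ)])) z • Literature.Barriers.HubbardSuperconductivity.bondPair z.1 z.2)ᴴ))).re + Real.log (Matrix.partitionFn β (hamiltonianWith ((Literature.Probability.LatticeModels.zdGraph 2).comap (fun p : (Lex (Fin m₂ × Fin n)) => ![((ofLex p).1 : ℤ), ((ofLex p).2 : ℤ)])) t U μ - (h : ℂ) • ((∑ z : (Lex (Fin m₂ × Fin n)) × (Lex (Fin m₂ × Fin n)), (fun z : (Lex (Fin m₂ × Fin n)) × (Lex (Fin m₂ × Fin n)) => ω (![((ofLex z.2).1 : ℤ), ((ofLex z.2).2 : ℤ)] - ![((ofLex z.1).1 : ℤ), ((ofLex z.1).2 : ℤ)])) z • Literature.Barriers.HubbardSuperconductivity.bondPair z.1 z.2) + (∑ z : (Lex (Fin m₂ × Fin n)) × (Lex (Fin m₂ × Fin n)), (fun z : (Lex (Fin m₂ × Fin n)) × (Lex (Fin m₂ × Fin n)) => ω (![((ofLex z.2).1 : ℤ),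 ((ofLex z.2).2 : ℤ)] - ![((ofLex z.1).1 : ℤ), ((ofLex z.1).2 : ℤ)])) z • Literature.Barriers.HubbardSuperconductivity.bondPair z.1 z.2)ᴴ))).re)| ≤ β * ((2 * |t| + 4 * |h|) * (2 * n)) :=
  fun ω hω₁ hωadj m₁ m₂ n _ t U μ h hβ => twR_rect_rowCut ω hω₁ hωadj (rfl : m₁ + m₂ = m₁ + m₂) n hβ t U μ h

end Summit.HubbardSuperconductivity.HubbardSuperconductivity.Theorems

end
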